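import Literature.AlgebraicGeometry.ModuliOfAbelianVarieties.SiegelFamilyRealLocusQuotient
import HarnessLib

/-!
# Goresky–Tai's Lemma 13 in every genus: `Γ(2)`-reality is a property of the `Sp_{2g}(ℤ)`-orbit —
# `Z` is `Γ_g(2)`-real iff `y • Z` is, for every `y ∈ Γ_g` («`τ(gz) = τ(g)τ(z) = (τ(g)g⁻¹)(gγg⁻¹)gZ ∈ Γ(2)·Γ(2)·gZ`»)
# (Goresky–Tai 2003, §5 Lemma 13 with §4 Lemma 9 (1))

Topic `Literature/AlgebraicGeometry/ModuliOfAbelianVarieties` (the Siegel-family files, namespace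
`Literature.AlgebraicGeometry.ModuliOfAbelianVarieties.SiegelModuli`).  Lane `lit-hodgefound` (Track 2
foundations library), prover seat p15 generation 51, row g51-#9, on top of g51-#8/#5/#4 (`ι(KηK) = τ(ι η)`,
Lemma 9 (1): `τ(η)η⁻¹ ∈ Γ(2)` for every `η ∈ Sp_{2g}(ℤ)`, normality of `Γⁿ(2)`), g51-#2 (`τ(ab) = τ(a)τ(b)`,
`τ(a⁻¹) = τ(a)⁻¹`) and g50-#7 (`τ(y) • τΩ = τ(y • Ω)`).  THEOREMS ONLY: no definition, no instance, no notation, no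
named fact (net Literature debt `0`), no `sorry`.

## Source, VERBATIM

M. Goresky, Y. S. Tai, Compositio Math. **139** (2003) = arXiv:math/0108103, held `paper:arxiv-math_0108103`, §5
p0009: «**Lemma 13.** A point `Z ∈ 𝔥_1` is `(Γ(2), τ)`-real if and only if `gZ` is `(Γ(2), τ)`-real, for every
`g ∈ SL(2, ℤ)`.  Proof.  Suppose `τ(Z) = γZ` for some `γ ∈ Γ(2)`.  Then
`τ(gz) = τ(g)τ(z) = (τ(g)g⁻¹)(gγg⁻¹) gZ ∈ Γ(2)·Γ(2)·gZ`.»  (The proof uses only Lemma 9 (1) with `m = 1` and the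
normality of `Γ(2)`, valid in every genus; §4.3: «`g̃g⁻¹ = I − (−2BᵗC 2BᵗA; 2CᵗD −2CᵗA)`.  This gives part (1)».)

## What is proved (`Γ_g = ι(Sp_{2g}(ℤ))`, `Γ_g(2) = ι(Γⁿ(2)) = (siegelPrincipalGamma g 2).map ι`, `τ(x) = I_* x I_*`)

* **`iStarConj_mul_mul_inv_mem_map_siegelPrincipalGamma_two`** — for `y ∈ Γ_g` and `x ∈ Γ_g(2)`:
  `τ(y)·x·y⁻¹ ∈ Γ_g(2)` («`(τ(g)g⁻¹)(gγg⁻¹) ∈ Γ(2)·Γ(2)`»).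
* **`exists_mem_siegelPrincipalGamma_two_smul_smul_eq_negConj_iff`** — LEMMA 13 in genus `g`: for `y ∈ Γ_g`,
  `y • Ω` is `Γ_g(2)`-real iff `Ω` is; `smul_mem_setOf_siegelPrincipalGamma_two_real_iff` (the set `S(2)` of
  `Γ_g(2)`-real points is `Γ_g`-stable).

## References

* [GoreskyTai2003RealModuli] M. Goresky, Y. S. Tai, Compositio Math. 139 (2003) 1–27, §4 Lemma 9 (1), §5 Lemma 13.
* [AndrianovZhuravlev2015] A. N. Andrianov, V. G. Zhuravlev, Ch. 2 §2.1 (2.1) (`Γⁿ(q)` normal in `Γⁿ`).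
-/

noncomputable section

open scoped Manifold Matrix ComplexConjugate
open Matrix Function

namespace Literature.AlgebraicGeometry.ModuliOfAbelianVarieties

namespace SiegelModuli

open Literature.NumberTheory.Automorphic (siegelUpperHalfSpace)
open Literature.NumberTheory.ModularForms.SiegelUpperHalfSpace (symplecticIntHom siegelModularGroup)
open Literature.NumberTheory.ModularForms.SiegelModularForm (siegelPrincipalGamma normal_siegelPrincipalGamma
  siegelPrincipalGamma_one)

variable {g : ℕ}

/-- **`τ(y)·x·y⁻¹ ∈ Γ_g(2)` for `y ∈ Γ_g`, `x ∈ Γ_g(2)`**: with `y = ι(η)`, `x = ι(γ)`,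
`τ(y)xy⁻¹ = ι((KηKη⁻¹)(ηγη⁻¹))`, `KηKη⁻¹ ∈ Γⁿ(2)` by Lemma 9 (1) (`m = 1`) and `ηγη⁻¹ ∈ Γⁿ(2)` by normality
(«`(τ(g)g⁻¹)(gγg⁻¹) ∈ Γ(2)·Γ(2)`»). [cite: GoreskyTai2003RealModuli, §5 proof of Lemma 13 and §4 Lemma 9 (1)] -/
theorem iStarConj_mul_mul_inv_mem_map_siegelPrincipalGamma_two {y x : Matrix.symplecticGroup (Fin g) ℝ}
    (hy : y ∈ siegelModularGroup g) (hx : x ∈ (siegelPrincipalGamma g 2).map (symplecticIntHom g)) :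
    (⟨Matrix.fromBlocks (-1 : Matrix (Fin g) (Fin g) ℝ) 0 0 (1 : Matrix (Fin g) (Fin g) ℝ) *
          (y : Matrix (Fin g ⊕ Fin g) (Fin g ⊕ Fin g) ℝ) *
          Matrix.fromBlocks (-1 : Matrix (Fin g) (Fin g) ℝ) 0 0 (1 : Matrix (Fin g) (Fin g) ℝ),
        iStar_mul_mul_iStar_mem_symplecticGroup y.2⟩ : Matrix.symplecticGroup (Fin g) ℝ) * x * y⁻¹ ∈
      (siegelPrincipalGamma g 2).map (symplecticIntHom g) := by
  obtain ⟨η, rfl⟩ := MonoidHom.mem_range.1 hy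
  obtain ⟨γ, hγ, rfl⟩ := Subgroup.mem_map.1 hx
  have hη1 : η ∈ siegelPrincipalGamma g 1 := by
    rw [siegelPrincipalGamma_one]; exact Subgroup.mem_top η
  refine Subgroup.mem_map.2 ⟨(⟨Matrix.fromBlocks (-1 : Matrix (Fin g) (Fin g) ℤ) 0 0 (1 : Matrix (Fin g) (Fin g) ℤ) *
        (η : Matrix (Fin g ⊕ Fin g) (Fin g ⊕ Fin g) ℤ) *
        Matrix.fromBlocks (-1 : Matrix (Fin g) (Fin g) ℤ) 0 0 (1 : Matrix (Fin g) (Fin g) ℤ),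
      iStar_mul_mul_iStar_mem_symplecticGroup η.2⟩ * η⁻¹) * (η * γ * η⁻¹), ?_, ?_⟩
  · refine (siegelPrincipalGamma g 2).mul_mem ?_ (normal_siegelPrincipalGamma.conj_mem γ hγ η)
    simpa using conjK_mul_inv_mem_siegelPrincipalGamma (m := 1) hη1
  · simp only [map_mul, map_inv, symplecticIntHom_conjK]
    group

/-- **LEMMA 13 IN GENUS `g`**: for `y ∈ Γ_g = Sp_{2g}(ℤ)`, the point `y • Ω` is `Γ_g(2)`-real iff `Ω` is
(«`τ(gz) = τ(g)τ(z) = (τ(g)g⁻¹)(gγg⁻¹) gZ ∈ Γ(2)·Γ(2)·gZ`»; transport `x ↦ τ(y)xy⁻¹` and back with `y⁻¹`).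
[cite: GoreskyTai2003RealModuli, §5 Lemma 13] -/
theorem exists_mem_siegelPrincipalGamma_two_smul_smul_eq_negConj_iff {y : Matrix.symplecticGroup (Fin g) ℝ}
    (hy : y ∈ siegelModularGroup g) (Ω : siegelUpperHalfSpace g) :
    (∃ γ ∈ siegelPrincipalGamma g 2, symplecticIntHom g γ • y • Ω =
        ⟨-((y • Ω : siegelUpperHalfSpace g) : Matrix (Fin g) (Fin g) ℂ).map conj,
          neg_map_conj_mem_siegelUpperHalfSpace (y • Ω).2⟩) ↔
      ∃ γ ∈ siegelPrincipalGamma g 2, symplecticIntHom g γ • Ω =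
        ⟨-(Ω : Matrix (Fin g) (Fin g) ℂ).map conj, neg_map_conj_mem_siegelUpperHalfSpace Ω.2⟩ := by
  rw [← iStar_smul_negConj y Ω]
  constructor
  · rintro ⟨γ, hγ, h⟩
    -- `x' = τ(y⁻¹) ι(γ) (y⁻¹)⁻¹ = τ(y)⁻¹ ι(γ) y`
    have hmem := iStarConj_mul_mul_inv_mem_map_siegelPrincipalGamma_two ((siegelModularGroup g).inv_mem hy)
      (Subgroup.mem_map.2 ⟨γ, hγ, rfl⟩)
    obtain ⟨γ', hγ', hγ'eq⟩ := Subgroup.mem_map.1 hmem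
    refine ⟨γ', hγ', ?_⟩
    rw [hγ'eq, inv_inv, mul_smul, mul_smul, h, iStarConj_inv, inv_smul_smul]
  · rintro ⟨γ, hγ, h⟩
    have hmem := iStarConj_mul_mul_inv_mem_map_siegelPrincipalGamma_two hy (Subgroup.mem_map.2 ⟨γ, hγ, rfl⟩)
    obtain ⟨γ', hγ', hγ'eq⟩ := Subgroup.mem_map.1 hmem
    refine ⟨γ', hγ', ?_⟩
    rw [hγ'eq, mul_smul, mul_smul, inv_smul_smul, h]

/-- **The set `S(2)` of `Γ_g(2)`-real points is `Γ_g`-stable**: `y • Ω ∈ S(2) ⟺ Ω ∈ S(2)` for `y ∈ Γ_g` — so the real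
points of `X(2) = Γ_g(2)∖𝔥_g` are permuted by the deck group `Γ_g/Γ_g(2) ≅ Sp_{2g}(ℤ/2)` and `S(2)` descends to a
well-defined subset of `𝔄_g`. [cite: GoreskyTai2003RealModuli, §5 Lemma 13 and Thm. 15] -/
theorem smul_mem_setOf_siegelPrincipalGamma_two_real_iff {y : Matrix.symplecticGroup (Fin g) ℝ}
    (hy : y ∈ siegelModularGroup g) (Ω : siegelUpperHalfSpace g) :
    y • Ω ∈ {Ω' : siegelUpperHalfSpace g | ∃ γ ∈ siegelPrincipalGamma g 2, symplecticIntHom g γ • Ω' =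
        ⟨-(Ω' : Matrix (Fin g) (Fin g) ℂ).map conj, neg_map_conj_mem_siegelUpperHalfSpace Ω'.2⟩} ↔
      Ω ∈ {Ω' : siegelUpperHalfSpace g | ∃ γ ∈ siegelPrincipalGamma g 2, symplecticIntHom g γ • Ω' =
        ⟨-(Ω' : Matrix (Fin g) (Fin g) ℂ).map conj, neg_map_conj_mem_siegelUpperHalfSpace Ω'.2⟩} :=
  exists_mem_siegelPrincipalGamma_two_smul_smul_eq_negConj_iff hy Ω

end SiegelModuli

end Literature.AlgebraicGeometry.ModuliOfAbelianVarieties
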